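import Summits.ResolutionOfSingularities.ResolutionOfSingularities.Theses.RuledResidues

/-!
# `RuledResidues.NonRuledDivisors` — line `automorphism-orbit`, stub `stub_transportNonRuled`

Registered stub of `Cruxes/NonRuledDivisors/Lines/automorphism_orbit.lean` (crux stmt-ResolutionOfSingularities-18075),
proved verbatim (signature = the registered one).  Non-ruledness of the residue field over `k` transfers along the `ι`-semilinear residue isomorphism `κ(W.comap τ) ≃+* κ(W)`.

Proof outline: (i) a generic transport lemma `ruled_transport`: ruledness data `(L', t')` on a
field `κ'` pushes forward along a field isomorphism `θ : κ' ≃+* κ` to `(θ(L'), θ t')` on `κ`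
(polynomials over `L'` are carried to polynomials over `θ(L')` by `Polynomial.map` along the
induced isomorphism `L' ≃+* θ(L')`, and evaluation commutes with `θ` by `Polynomial.hom_eval₂`);
(ii) `τ` restricts to a ring isomorphism `W.comap τ ≃+* W`, whence a residue isomorphism
`θ := IsLocalRing.ResidueField.mapEquiv _ : κ(W.comap τ) ≃+* κ(W)` with
`θ (residue (algebraMap c)) = residue (algebraMap (ι c))`; since `ι` is bijective the image of `k`
in `κ(W)` is covered, and the contrapositive of the claim follows from (i).
-/

-- dupNamespace: the problem namespace legitimately repeats the summit name
set_option linter.dupNamespace false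

namespace Summit.ResolutionOfSingularities.ResolutionOfSingularities.Theorems

/-- **Transport of a ruling along a field isomorphism.**  Let `θ : κ' ≃+* κ` be a field
isomorphism and `r' : σ → κ'`, `r : σ → κ` two families such that every `r c` is `θ` of some
`r' c'`.  If `κ'` is ruled by `(L', t')` with all `r' c ∈ L'` — i.e. `t'` is transcendental over
the subfield `L'` and every element of `κ'` is a fraction `f(t')/g(t')` with `f, g ∈ L'[X]` — then
`κ` is ruled by `(θ(L'), θ t')` with all `r c ∈ θ(L')`. [folklore] -/
theorem ruled_transport {κ κ' σ : Type*} [Field κ] [Field κ'] (θ : κ' ≃+* κ)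
    (r' : σ → κ') (r : σ → κ) (hr : ∀ c, ∃ c', θ (r' c') = r c)
    (h : ∃ (L : Subfield κ') (t : κ'), (∀ c, r' c ∈ L) ∧
      (∀ f : Polynomial L, f ≠ 0 → Polynomial.eval₂ L.subtype t f ≠ 0) ∧
      (∀ x : κ', ∃ f g : Polynomial L, Polynomial.eval₂ L.subtype t g ≠ 0 ∧
        x * Polynomial.eval₂ L.subtype t g = Polynomial.eval₂ L.subtype t f)) :
    ∃ (L : Subfield κ) (t : κ), (∀ c, r c ∈ L) ∧
      (∀ f : Polynomial L, f ≠ 0 → Polynomial.eval₂ L.subtype t f ≠ 0) ∧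
      (∀ x : κ, ∃ f g : Polynomial L, Polynomial.eval₂ L.subtype t g ≠ 0 ∧
        x * Polynomial.eval₂ L.subtype t g = Polynomial.eval₂ L.subtype t f) := by
  obtain ⟨L', t', hL'r, htr', hfr'⟩ := h
  -- the image subfield `θ(L')`, written as the preimage under `θ.symm` (definitional membership)
  let L : Subfield κ := L'.comap (θ.symm : κ →+* κ')
  have hmemL : ∀ {x : κ}, x ∈ L ↔ θ.symm x ∈ L' := fun {x} => Iff.rfl
  -- the induced isomorphism `L' ≃+* θ(L')`
  let eL : L' ≃+* L :=
    { toFun := fun x => ⟨θ x, hmemL.mpr (by rw [θ.symm_apply_apply]; exact x.2)⟩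
      invFun := fun y => ⟨θ.symm y, hmemL.mp y.2⟩
      left_inv := fun x => Subtype.ext (θ.symm_apply_apply _)
      right_inv := fun y => Subtype.ext (θ.apply_symm_apply _)
      map_mul' := fun x y => Subtype.ext (map_mul θ _ _)
      map_add' := fun x y => Subtype.ext (map_add θ _ _) }
  have hcomp : L.subtype.comp (eL : L' →+* L) = (θ : κ' →+* κ).comp L'.subtype :=
    RingHom.ext fun _ => rfl
  -- evaluation at `θ t'` of the transported polynomial is `θ` of the evaluation at `t'`
  have heval : ∀ f' : Polynomial L',
      Polynomial.eval₂ L.subtype (θ t') (f'.map (eL : L' →+* L)) =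
        θ (Polynomial.eval₂ L'.subtype t' f') := by
    intro f'
    have h := Polynomial.hom_eval₂ f' L'.subtype (θ : κ' →+* κ) t'
    rw [RingHom.coe_coe] at h
    rw [Polynomial.eval₂_map, hcomp, h]
  -- every polynomial over `θ(L')` is the transport of one over `L'`
  have hback : ∀ f : Polynomial L, (f.map (eL.symm : L →+* L')).map (eL : L' →+* L) = f := by
    intro f
    rw [Polynomial.map_map, RingEquiv.comp_symm, Polynomial.map_id]
  refine ⟨L, θ t', ?_, ?_, ?_⟩
  · intro c
    obtain ⟨c', hc'⟩ := hr c
    rw [← hc']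
    exact hmemL.mpr (by rw [θ.symm_apply_apply]; exact hL'r c')
  · intro f hf hft
    have hf' : f.map (eL.symm : L →+* L') ≠ 0 := by
      intro h0
      apply hf
      rw [← hback f, h0, Polynomial.map_zero]
    refine htr' _ hf' (θ.injective ?_)
    rw [← heval, hback, hft, map_zero]
  · intro x
    obtain ⟨f', g', hg', hx'⟩ := hfr' (θ.symm x)
    refine ⟨f'.map (eL : L' →+* L), g'.map (eL : L' →+* L), ?_, ?_⟩
    · rw [heval]
      exact θ.map_ne_zero_iff.mpr hg'
    · rw [heval, heval, ← hx', map_mul, θ.apply_symm_apply]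

/-- Stub 2c of line `automorphism-orbit` (crux `RuledResidues.NonRuledDivisors`): if `κ(W)` is not ruled over `k` then neither is `κ(W.comap τ)`, for `τ` semilinear over an automorphism `ι` of `k`. [folklore] -/
theorem stub_transportNonRuled : ∀ (k K : Type) [Field k] [Field K] [Algebra k K] (τ : K ≃+* K) (ι : k ≃+* k), (∀ c : k, τ (algebraMap k K c) = algebraMap k K (ι c)) → ∀ (W W' : ValuationSubring K), W' = W.comap (τ : K →+* K) → ∀ (hk : ∀ c : k, algebraMap k K c ∈ W) (hk' : ∀ c : k, algebraMap k K c ∈ W'), ¬ (∃ (L : Subfield (IsLocalRing.ResidueField W)) (t : IsLocalRing.ResidueField W), (∀ c : k, IsLocalRing.residue W ⟨algebraMap k K c, hk c⟩ ∈ L) ∧ (∀ f : Polynomial L, f ≠ 0 → Polynomial.eval₂ L.subtype t f ≠ 0) ∧ (∀ x : IsLocalRing.ResidueField W, ∃ f g : Polynomial L, Polynomial.eval₂ L.subtype t g ≠ 0 ∧ x * Polynomial.eval₂ L.subtype t g = Polynomial.eval₂ L.subtype t f)) → ¬ (∃ (L : Subfield (IsLocalRing.ResidueField W')) (t : IsLocalRing.ResidueField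 W'), (∀ c : k, IsLocalRing.residue W' ⟨algebraMap k K c, hk' c⟩ ∈ L) ∧ (∀ f : Polynomial L, f ≠ 0 → Polynomial.eval₂ L.subtype t f ≠ 0) ∧ (∀ x : IsLocalRing.ResidueField W', ∃ f g : Polynomial L, Polynomial.eval₂ L.subtype t g ≠ 0 ∧ x * Polynomial.eval₂ L.subtype t g = Polynomial.eval₂ L.subtype t f)) := by
  intro k K _ _ _ τ ι hsemi W W' hW' hk hk' hnr hr'
  subst hW'
  -- `τ` restricts to a ring isomorphism `W.comap τ ≃+* W`
  let e : W.comap (τ : K →+* K) ≃+* W :=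
    { toFun := fun y => ⟨τ y, y.2⟩
      invFun := fun y => ⟨τ.symm y, show τ (τ.symm y) ∈ W by rw [τ.apply_symm_apply]; exact y.2⟩
      left_inv := fun y => Subtype.ext (τ.symm_apply_apply _)
      right_inv := fun y => Subtype.ext (τ.apply_symm_apply _)
      map_mul' := fun y z => Subtype.ext (map_mul τ _ _)
      map_add' := fun y z => Subtype.ext (map_add τ _ _) }
  -- the induced residue isomorphism maps the class of `algebraMap c` to the class of `algebraMap (ι c)`
  refine hnr (ruled_transport (IsLocalRing.ResidueField.mapEquiv e)
    (fun c => IsLocalRing.residue (W.comap (τ : K →+* K)) ⟨algebraMap k K c, hk' c⟩)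
    (fun c => IsLocalRing.residue W ⟨algebraMap k K c, hk c⟩) (fun c => ⟨ι.symm c, ?_⟩) hr')
  rw [IsLocalRing.ResidueField.mapEquiv_apply, IsLocalRing.ResidueField.map_residue]
  congr 1
  refine Subtype.ext ?_
  show τ (algebraMap k K (ι.symm c)) = algebraMap k K c
  rw [hsemi, ι.apply_symm_apply]

end Summit.ResolutionOfSingularities.ResolutionOfSingularities.Theorems
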